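import Summits.QuantumFields.YangMills.Theorems.UnitScaleTiltProp8ChartDeriv
import Summits.QuantumFields.YangMills.Theorems.UnitScaleTiltProp8ChartLocality
import Literature.MathematicalPhysics.QuantumFieldTheory.Balaban1983to89.BlockAveragingEMLAnalyticMean
import Literature.MathematicalPhysics.QuantumFieldTheory.Balaban1983to89.BlockAveragingTwoLevel
import Literature.MathematicalPhysics.QuantumFieldTheory.Balaban1983to89.LatticeWordStokes
import HarnessLib

/-!
# Route `UnitScaleTilt`, crux K1 «MinimiserStabilityRegPr» (stmt-QuantumFields-19200), leaf V2′ `stub_halvingStep` — pillar P3 `ChartPerLevel`: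
# **TRANSPORTS AND (0.4) LOOP VARIABLES OF NEAR-FLAT `𝔸ˣ`-VALUED (COMPLEXIFIED) FIELDS TO FIRST ORDER** (the segment and loop letters of
# [Balaban1985Averaging] Prop. 3 (122)–(123) for the UNGUARDED average `Prop8Chart.emlAvgU`; file 1 of 2, the average itself is `…Prop8ChartOneStep`)

Cell `ym3-torus` ∕ fleet seat `ym-ust-19200-p2` g6 (v8 PEN).  The chart of pillar P3 (`ChartRemainderAt`, p539223) reads the multi-level (0.4) data of the
complexified fields `e^{iηA}` ([Balaban1985Variational] (152)) through the UNGUARDED average on the units of a complete normed `ℂ`-algebra (p535818).  The tree's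
segment letters (p482040 `BlockAveragingEMLLinearised.norm_holAt_sub_one_sub_walkSum_le`) are for `SU(N)`; here their twins for `𝔸ˣ` (no unitarity: inverses to
second order by `u⁻¹ − 1 + (u − 1) = (u⁻¹ − 1)(1 − u)`, `‖1‖ = 1`), with hypotheses placed ONLY ON THE BONDS OF THE WALK (so that the two-block read sets of
`Prop8ChartLocality` feed them):
* §1 inverses of near-`1` units (`norm_inv_sub_one_le_two_mul`, `norm_inv_sub_one_add_le`), signed sums and means bounded through their own bonds;
* §2 **`norm_holT_sub_one_sub_walkSum_le_of_steps`**: `‖S(Γ) − 1‖ ≤ (1+2s)^m − 1`, `‖S(Γ) − 1 − Z(Γ)‖ ≤ (1+2s)^m − 1 − 2ms + 2ms²` (`Z = S − 1`, `m = |Γ|`), and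
  for `m ≤ m₀`, `4m₀s ≤ 1`: `≤ 4m₀s`, `≤ 10m₀²s²` (`…_of_length_le`);
* §3 the (0.4) loop variables (`norm_loopHolU_sub_one_le`: `≤ 4ℓs`, `≤ 10ℓ²s²`, `ℓ = (d+2)L`) and their `exp[mean log]` to second order
  (**`norm_eml_loopHolU_sub_one_sub_mean_le`**: `‖eml W − 1 − |I|⁻¹Σ_i Z(loop_i)‖ ≤ 586ℓ²s²`, `‖eml W − 1‖ ≤ 16ℓs`, for `48ℓs ≤ 1`;
  `BlockAveragingEMLAnalyticMean.norm_eml_one_add_sub_sub_mean_le` at radius `1/12`).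
Sorry-free, definition-free.  NOT a claim about the mass gap.

References: T. Bałaban, CMP **98** (1985) 17–51 [Balaban1985Averaging] ((122)–(123) p.36); CMP **109** (1987) 249–301 [Balaban1987RG1] ((0.4)–(0.8) p.253).
-/

noncomputable section

open scoped BigOperators
open NormedSpace

namespace Summit.QuantumFields.YangMills.Theorems.Prop8Chart

open Literature.MathematicalPhysics.QuantumFieldTheory.Balaban1983to89
open T4Continuum BlockAveraging AveragingRT ExpMeanLog MatrixLog BlockAveragingEMLLinearised
open B10Eq27TorusAxialLog (holT holT_nil holT_cons_true holT_cons_false)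
open B7TransferAnalyticMean (meanCLM meanCLM_apply norm_exp_sub_one_le_two_mul norm_exp_sub_one_sub_self_le)
open BlockAveragingEMLAnalyticMean (norm_eml_one_add_sub_sub_mean_le)
open LatticeWordStokes (length_loopWord_le)

variable {P : Params} {j : ℕ}

/-! ## §1 Numeric envelopes, inverses and signed sums -/

section Prelim

/-- `(1+b)^m ≤ 2` when `m·b ≤ ½` (`b ≥ 0`). [folklore] -/
private theorem one_add_pow_le_two {b : ℝ} (hb : 0 ≤ b) {m : ℕ} (hmb : (m : ℝ) * b ≤ 1 / 2) : (1 + b) ^ m ≤ 2 := by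
  have h1 : (1 + b) ^ m ≤ Real.exp b ^ m := pow_le_pow_left₀ (by linarith) (by linarith [Real.add_one_le_exp b]) m
  have h2 : Real.exp b ^ m = Real.exp ((m : ℝ) * b) := by rw [← Real.exp_nat_mul]
  have h3 : Real.exp ((m : ℝ) * b) ≤ Real.exp (1 / 2) := Real.exp_le_exp.2 hmb
  have h4 : Real.exp (1 / 2) ≤ 2 := by
    have he : Real.exp (1 / 2) ^ 2 = Real.exp 1 := by rw [← Real.exp_nat_mul]; norm_num
    have h9 := Real.exp_one_lt_d9
    nlinarith [Real.exp_pos (1 / 2 : ℝ)]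
  linarith

/-- `(1+b)^m − 1 ≤ m·b·(1+b)^m` (`b ≥ 0`). [folklore] -/
private theorem one_add_pow_sub_one_le (b : ℝ) (hb : 0 ≤ b) : ∀ m : ℕ, (1 + b) ^ m - 1 ≤ m * b * (1 + b) ^ m
  | 0 => by simp
  | m + 1 => by
    have ih := one_add_pow_sub_one_le b hb m
    have hm : (0 : ℝ) ≤ m := Nat.cast_nonneg m
    have hp : (0 : ℝ) ≤ (1 + b) ^ m := pow_nonneg (by linarith) m
    push_cast
    rw [pow_succ]
    nlinarith [mul_nonneg (mul_nonneg hm hb) hp, mul_nonneg hb hp]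

/-- `(1+b)^m − 1 − m·b ≤ m²·b²·(1+b)^m` (`b ≥ 0`). [folklore] -/
private theorem one_add_pow_sub_one_sub_mul_le (b : ℝ) (hb : 0 ≤ b) :
    ∀ m : ℕ, (1 + b) ^ m - 1 - m * b ≤ (m : ℝ) ^ 2 * b ^ 2 * (1 + b) ^ m
  | 0 => by simp
  | m + 1 => by
    have ih := one_add_pow_sub_one_sub_mul_le b hb m
    have ih₁ := one_add_pow_sub_one_le b hb m
    have hm : (0 : ℝ) ≤ m := Nat.cast_nonneg m
    have hp : (1 : ℝ) ≤ (1 + b) ^ m := one_le_pow₀ (by linarith)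
    push_cast
    rw [pow_succ]
    nlinarith [mul_nonneg (mul_nonneg hm hb) (mul_nonneg hb (sub_nonneg.2 hp)), mul_nonneg hm (mul_nonneg hb hb),
      mul_nonneg (mul_nonneg hb hb) (sub_nonneg.2 hp)]

variable {𝔸 : Type*} [NormedRing 𝔸] [NormOneClass 𝔸]

/-- **THE INVERSE OF A NEAR-`1` UNIT**: `‖u⁻¹ − 1‖ ≤ 2s` if `‖u − 1‖ ≤ s ≤ ½` (`u⁻¹ − 1 = u⁻¹(1 − u)`). [folklore] -/
theorem norm_inv_sub_one_le_two_mul {u : 𝔸ˣ} {s : ℝ} (hu : ‖(u : 𝔸) - 1‖ ≤ s) (hs : s ≤ 1 / 2) :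
    ‖((u⁻¹ : 𝔸ˣ) : 𝔸) - 1‖ ≤ 2 * s := by
  have hs0 : 0 ≤ s := (norm_nonneg _).trans hu
  have e : ((u⁻¹ : 𝔸ˣ) : 𝔸) - 1 = ((u⁻¹ : 𝔸ˣ) : 𝔸) * (1 - (u : 𝔸)) := by
    rw [mul_sub, mul_one, Units.inv_mul]
  have h1 : ‖((u⁻¹ : 𝔸ˣ) : 𝔸) - 1‖ ≤ (‖((u⁻¹ : 𝔸ˣ) : 𝔸) - 1‖ + 1) * s := by
    calc ‖((u⁻¹ : 𝔸ˣ) : 𝔸) - 1‖ = ‖((u⁻¹ : 𝔸ˣ) : 𝔸) * (1 - (u : 𝔸))‖ := by rw [← e]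
      _ ≤ ‖((u⁻¹ : 𝔸ˣ) : 𝔸)‖ * ‖1 - (u : 𝔸)‖ := norm_mul_le _ _
      _ ≤ (‖((u⁻¹ : 𝔸ˣ) : 𝔸) - 1‖ + ‖(1 : 𝔸)‖) * s := by
          gcongr
          · exact norm_le_norm_sub_add _ _ |>.trans (by rw [norm_one])
          · rwa [norm_sub_rev]
      _ = (‖((u⁻¹ : 𝔸ˣ) : 𝔸) - 1‖ + 1) * s := by rw [norm_one]
  nlinarith [norm_nonneg (((u⁻¹ : 𝔸ˣ) : 𝔸) - 1)]

/-- **THE INVERSE TO SECOND ORDER**: `‖u⁻¹ − 1 + (u − 1)‖ ≤ 2s²` if `‖u − 1‖ ≤ s ≤ ½` (`u⁻¹ − 1 + (u − 1) = (u⁻¹ − 1)(1 − u)`). [folklore] -/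
theorem norm_inv_sub_one_add_le {u : 𝔸ˣ} {s : ℝ} (hu : ‖(u : 𝔸) - 1‖ ≤ s) (hs : s ≤ 1 / 2) :
    ‖((u⁻¹ : 𝔸ˣ) : 𝔸) - 1 + ((u : 𝔸) - 1)‖ ≤ 2 * s ^ 2 := by
  have hs0 : 0 ≤ s := (norm_nonneg _).trans hu
  have e : ((u⁻¹ : 𝔸ˣ) : 𝔸) - 1 + ((u : 𝔸) - 1) = (((u⁻¹ : 𝔸ˣ) : 𝔸) - 1) * (1 - (u : 𝔸)) := by
    rw [sub_mul, mul_sub, mul_one, Units.inv_mul, one_mul]; abel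
  rw [e]
  calc ‖(((u⁻¹ : 𝔸ˣ) : 𝔸) - 1) * (1 - (u : 𝔸))‖ ≤ ‖((u⁻¹ : 𝔸ˣ) : 𝔸) - 1‖ * ‖1 - (u : 𝔸)‖ := norm_mul_le _ _
    _ ≤ (2 * s) * s := by
        gcongr
        · exact norm_inv_sub_one_le_two_mul hu hs
        · rwa [norm_sub_rev]
    _ = 2 * s ^ 2 := by ring

omit [NormOneClass 𝔸] in
/-- A signed sum along a walk is bounded by the length times the bound on ITS bonds. [cite: Balaban1984PropagatorsI, (1.8) p.19] -/
theorem norm_walkSum_le_of_steps {V : Type*} [SeminormedAddCommGroup V] (Y : PBond P j → V) {s : ℝ} :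
    ∀ γ : List (LStep P j), (∀ st ∈ γ, ‖Y st.bond‖ ≤ s) → ‖walkSum Y γ‖ ≤ γ.length * s
  | [], _ => by simp [walkSum_nil]
  | st :: γ, h => by
    rw [walkSum_cons, List.length_cons]
    have h1 : ‖(if st.fwd then Y st.bond else -Y st.bond)‖ ≤ s := by
      split_ifs
      · exact h st (by simp)
      · rw [norm_neg]; exact h st (by simp)
    have ih := norm_walkSum_le_of_steps Y γ fun st' hst' => h st' (by simp [hst'])
    calc _ ≤ ‖(if st.fwd then Y st.bond else -Y st.bond)‖ + ‖walkSum Y γ‖ := norm_add_le _ _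
      _ ≤ s + γ.length * s := add_le_add h1 ih
      _ = ((γ.length + 1 : ℕ) : ℝ) * s := by push_cast; ring

omit [NormOneClass 𝔸] in
/-- The mean of a family bounded by `t` is bounded by `t`. [folklore] -/
theorem norm_card_inv_smul_sum_le {ι : Type*} [Fintype ι] {M : Type*} [SeminormedAddCommGroup M] [NormedSpace ℂ M] {a : ι → M} {t : ℝ}
    (ht : 0 ≤ t) (h : ∀ i, ‖a i‖ ≤ t) : ‖((Fintype.card ι : ℂ))⁻¹ • ∑ i, a i‖ ≤ t := by
  rcases isEmpty_or_nonempty ι with hι | hι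
  · simp [ht]
  have hc : (0 : ℝ) < Fintype.card ι := Nat.cast_pos.mpr Fintype.card_pos
  have hsum : ∑ i, ‖a i‖ ≤ ∑ _i : ι, t := Finset.sum_le_sum fun i _ => h i
  rw [Finset.sum_const, Finset.card_univ, nsmul_eq_mul] at hsum
  rw [norm_smul, norm_inv, Complex.norm_natCast, inv_mul_le_iff₀ hc]
  exact (norm_sum_le _ _).trans hsum

end Prelim

/-! ## §2 Transports to first order in the bond deviations -/

section Transport

variable {𝔸 : Type*} [NormedRing 𝔸] [NormOneClass 𝔸]

/-- **TRANSPORTS OF NEAR-FLAT `𝔸ˣ`-FIELDS TO ZEROTH AND FIRST ORDER**: if every bond variable ON THE WALK satisfies `‖S(b) − 1‖ ≤ s ≤ ½`, then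
`‖S(Γ) − 1‖ ≤ (1+2s)^m − 1` and `‖S(Γ) − 1 − Z(Γ)‖ ≤ (1+2s)^m − 1 − 2ms + 2ms²` (`m = |Γ|`, `Z = S − 1`, `Z(Γ)` the signed sum `walkSum`; every step factor
`S(b)^{±1}` is within `2s` of `1` and within `2s²` of `1 ± Z(b)`). [cite: Balaban1985Averaging, (122)-(123) p.36] -/
theorem norm_holT_sub_one_sub_walkSum_le_of_steps {S : GaugeField P j 𝔸ˣ} {s : ℝ} (hs0 : 0 ≤ s) (hs : s ≤ 1 / 2) :
    ∀ (w : List (Letter P.d)) (x : Site P j), (∀ st ∈ walk x w, ‖((S st.bond : 𝔸ˣ) : 𝔸) - 1‖ ≤ s) →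
      ‖((holT S x w : 𝔸ˣ) : 𝔸) - 1‖ ≤ (1 + 2 * s) ^ w.length - 1 ∧
      ‖((holT S x w : 𝔸ˣ) : 𝔸) - 1 - walkSum (fun b => ((S b : 𝔸ˣ) : 𝔸) - 1) (walk x w)‖ ≤
        (1 + 2 * s) ^ w.length - 1 - w.length * (2 * s) + w.length * (2 * s ^ 2)
  | [], x, _ => by simp [holT_nil, walk, walkSum_nil]
  | (μ, fwd) :: w, x, h => by
    -- the step factor `f`, the rest `T`, and their letters
    have key : ∀ (f T : 𝔸) (σ τ : 𝔸) (n : ℕ), ‖f - 1‖ ≤ 2 * s → ‖f - 1 - σ‖ ≤ 2 * s ^ 2 →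
        ‖T - 1‖ ≤ (1 + 2 * s) ^ n - 1 → ‖T - 1 - τ‖ ≤ (1 + 2 * s) ^ n - 1 - n * (2 * s) + n * (2 * s ^ 2) →
        ‖f * T - 1‖ ≤ (1 + 2 * s) ^ (n + 1) - 1 ∧
        ‖f * T - 1 - (σ + τ)‖ ≤ (1 + 2 * s) ^ (n + 1) - 1 - ((n + 1 : ℕ) : ℝ) * (2 * s) + ((n + 1 : ℕ) : ℝ) * (2 * s ^ 2) := by
      intro f T σ τ n hf hfσ hT hTτ
      have hA : 0 ≤ (1 + 2 * s) ^ n - 1 := by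
        have : (1 : ℝ) ≤ (1 + 2 * s) ^ n := one_le_pow₀ (by linarith)
        linarith
      constructor
      · have e : f * T - 1 = (f - 1) * (T - 1) + (f - 1) + (T - 1) := by noncomm_ring
        rw [e]
        calc _ ≤ ‖f - 1‖ * ‖T - 1‖ + ‖f - 1‖ + ‖T - 1‖ :=
              (norm_add_le _ _).trans (add_le_add ((norm_add_le _ _).trans (add_le_add (norm_mul_le _ _) le_rfl)) le_rfl)
          _ ≤ (2 * s) * ((1 + 2 * s) ^ n - 1) + 2 * s + ((1 + 2 * s) ^ n - 1) := by gcongr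
          _ = (1 + 2 * s) ^ (n + 1) - 1 := by ring
      · have e : f * T - 1 - (σ + τ) = (f - 1) * (T - 1) + (f - 1 - σ) + (T - 1 - τ) := by noncomm_ring
        rw [e]
        calc _ ≤ ‖f - 1‖ * ‖T - 1‖ + ‖f - 1 - σ‖ + ‖T - 1 - τ‖ :=
              (norm_add_le _ _).trans (add_le_add ((norm_add_le _ _).trans (add_le_add (norm_mul_le _ _) le_rfl)) le_rfl)
          _ ≤ (2 * s) * ((1 + 2 * s) ^ n - 1) + 2 * s ^ 2 + ((1 + 2 * s) ^ n - 1 - n * (2 * s) + n * (2 * s ^ 2)) := by gcongr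
          _ = _ := by push_cast; ring
    cases fwd with
    | true =>
      have hb : ‖((S ⟨x, μ⟩ : 𝔸ˣ) : 𝔸) - 1‖ ≤ s := h ⟨⟨x, μ⟩, true⟩ (by simp [walk])
      obtain ⟨ih1, ih2⟩ := norm_holT_sub_one_sub_walkSum_le_of_steps hs0 hs w (x.shift μ) fun st hst => h st (by simp [walk, hst])
      have hk := key ((S ⟨x, μ⟩ : 𝔸ˣ) : 𝔸) ((holT S (x.shift μ) w : 𝔸ˣ) : 𝔸) (((S ⟨x, μ⟩ : 𝔸ˣ) : 𝔸) - 1)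
        (walkSum (fun b => ((S b : 𝔸ˣ) : 𝔸) - 1) (walk (x.shift μ) w)) w.length (by linarith) (by rw [sub_self, norm_zero]; positivity) ih1 ih2
      simpa only [holT_cons_true, Units.val_mul, walk, walkSum_cons, if_true, List.length_cons] using hk
    | false =>
      have hb : ‖((S ⟨x.unshift μ, μ⟩ : 𝔸ˣ) : 𝔸) - 1‖ ≤ s := h ⟨⟨x.unshift μ, μ⟩, false⟩ (by simp [walk])
      obtain ⟨ih1, ih2⟩ := norm_holT_sub_one_sub_walkSum_le_of_steps hs0 hs w (x.unshift μ) fun st hst => h st (by simp [walk, hst])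
      have hk := key (((S ⟨x.unshift μ, μ⟩)⁻¹ : 𝔸ˣ) : 𝔸) ((holT S (x.unshift μ) w : 𝔸ˣ) : 𝔸) (-(((S ⟨x.unshift μ, μ⟩ : 𝔸ˣ) : 𝔸) - 1))
        (walkSum (fun b => ((S b : 𝔸ˣ) : 𝔸) - 1) (walk (x.unshift μ) w)) w.length (norm_inv_sub_one_le_two_mul hb hs)
        (by rw [sub_neg_eq_add]; exact norm_inv_sub_one_add_le hb hs) ih1 ih2
      simpa only [holT_cons_false, Units.val_mul, walk, walkSum_cons, Bool.false_eq_true, if_false, List.length_cons] using hk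

/-- **SEGMENTS OF AT MOST `m` STEPS, `4ms ≤ 1`**: `‖S(Γ) − 1‖ ≤ 4·m·s` and `‖S(Γ) − 1 − Z(Γ)‖ ≤ 10·m²·s²`. [cite: Balaban1985Averaging, (122)-(123) p.36] -/
theorem norm_holT_sub_one_sub_walkSum_le_of_length_le {S : GaugeField P j 𝔸ˣ} {s : ℝ} (hs0 : 0 ≤ s) {m : ℕ} (hm1 : 1 ≤ m)
    (hms : 4 * (m : ℝ) * s ≤ 1) (w : List (Letter P.d)) (x : Site P j) (hw : w.length ≤ m)
    (h : ∀ st ∈ walk x w, ‖((S st.bond : 𝔸ˣ) : 𝔸) - 1‖ ≤ s) :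
    ‖((holT S x w : 𝔸ˣ) : 𝔸) - 1‖ ≤ 4 * m * s ∧
      ‖((holT S x w : 𝔸ˣ) : 𝔸) - 1 - walkSum (fun b => ((S b : 𝔸ˣ) : 𝔸) - 1) (walk x w)‖ ≤ 10 * (m : ℝ) ^ 2 * s ^ 2 := by
  have hm0 : (1 : ℝ) ≤ m := by exact_mod_cast hm1
  have hs : s ≤ 1 / 2 := by nlinarith
  obtain ⟨h1, h2⟩ := norm_holT_sub_one_sub_walkSum_le_of_steps hs0 hs w x h
  set t : ℝ := 2 * s with ht
  have ht0 : 0 ≤ t := by positivity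
  have hlen : (w.length : ℝ) ≤ m := by exact_mod_cast hw
  have hnt : (w.length : ℝ) * t ≤ 1 / 2 := by rw [ht]; nlinarith
  have hpow2 : (1 + t) ^ w.length ≤ 2 := one_add_pow_le_two ht0 hnt
  have hA := one_add_pow_sub_one_le t ht0 w.length
  have hB := one_add_pow_sub_one_sub_mul_le t ht0 w.length
  have hl0 : (0 : ℝ) ≤ w.length := Nat.cast_nonneg _
  constructor
  · calc _ ≤ (1 + t) ^ w.length - 1 := h1
      _ ≤ w.length * t * (1 + t) ^ w.length := hA
      _ ≤ w.length * t * 2 := mul_le_mul_of_nonneg_left hpow2 (by positivity)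
      _ ≤ 4 * m * s := by rw [ht]; nlinarith
  · calc _ ≤ (1 + t) ^ w.length - 1 - w.length * t + w.length * (2 * s ^ 2) := h2
      _ ≤ (w.length : ℝ) ^ 2 * t ^ 2 * (1 + t) ^ w.length + w.length * (2 * s ^ 2) := by linarith
      _ ≤ (w.length : ℝ) ^ 2 * t ^ 2 * 2 + w.length * (2 * s ^ 2) := by gcongr
      _ ≤ (m : ℝ) ^ 2 * t ^ 2 * 2 + m * (2 * s ^ 2) := by gcongr
      _ = 8 * (m : ℝ) ^ 2 * s ^ 2 + 2 * m * s ^ 2 := by rw [ht]; ring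
      _ ≤ 10 * (m : ℝ) ^ 2 * s ^ 2 := by nlinarith [sq_nonneg s, mul_nonneg (sub_nonneg.2 hm0) (sq_nonneg s)]

end Transport

/-! ## §3 The loop variables and their `exp[mean log]` -/

section Loops

variable {𝔸 : Type*} [NormedRing 𝔸] [NormedAlgebra ℂ 𝔸] [CompleteSpace 𝔸] [NormOneClass 𝔸]

/-- Every step of a (0.4) loop walk reads a two-block bond (both ends in `B(c₋) ∪ B(c₊)`). [cite: Balaban1987RG1, (0.4) p.253] -/
theorem two_block_of_mem_loopWalk (hj : j + 1 ≤ P.m + P.K) (c : PBond P (j + 1)) (i : Idx P) {st : LStep P j}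
    (hst : st ∈ walk (emb c.src) (loopWord P.L c.dir (off i.1) i.2.1 i.2.2)) :
    (blockOf st.bond.src = c.src ∨ blockOf st.bond.src = c.tgt) ∧ (blockOf st.bond.tgt = c.src ∨ blockOf st.bond.tgt = c.tgt) :=
  ⟨blockOf_src_of_mem_walk hj c i st hst, T4ReflectionConeSharp.blockOf_tgt_of_mem_walk hj c i st hst⟩

omit [NormedAlgebra ℂ 𝔸] [CompleteSpace 𝔸] in
/-- **THE (0.4) LOOP VARIABLES OF A NEAR-FLAT `𝔸ˣ`-FIELD TO FIRST ORDER**: `‖W_i − 1‖ ≤ 4ℓs` and `‖W_i − 1 − Z(loop_i)‖ ≤ 10ℓ²s²` when `‖S(b) − 1‖ ≤ s` on the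
two-block bonds of `c` and `4ℓs ≤ 1` (`ℓ = (d+2)L` bounds the loop lengths, `LatticeWordStokes.length_loopWord_le`). [cite: Balaban1985Averaging, (122)-(123) p.36] -/
theorem norm_loopHolU_sub_one_le (hj : j + 1 ≤ P.m + P.K) {S : GaugeField P j 𝔸ˣ} (c : PBond P (j + 1)) {s : ℝ} (hs0 : 0 ≤ s)
    (hℓs : 4 * (((P.d + 2) * P.L : ℕ) : ℝ) * s ≤ 1)
    (hS : ∀ b : PBond P j, (blockOf b.src = c.src ∨ blockOf b.src = c.tgt) → (blockOf b.tgt = c.src ∨ blockOf b.tgt = c.tgt) →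
      ‖((S b : 𝔸ˣ) : 𝔸) - 1‖ ≤ s) (i : Idx P) :
    ‖((loopHolU S c i : 𝔸ˣ) : 𝔸) - 1‖ ≤ 4 * (((P.d + 2) * P.L : ℕ) : ℝ) * s ∧
      ‖((loopHolU S c i : 𝔸ˣ) : 𝔸) - 1 -
          walkSum (fun b => ((S b : 𝔸ˣ) : 𝔸) - 1) (walk (emb c.src) (loopWord P.L c.dir (off i.1) i.2.1 i.2.2))‖ ≤
        10 * (((P.d + 2) * P.L : ℕ) : ℝ) ^ 2 * s ^ 2 := by
  have hℓ1 : 1 ≤ (P.d + 2) * P.L := Nat.one_le_iff_ne_zero.mpr (Nat.mul_ne_zero (by omega) (by have := P.hL.2; omega))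
  unfold loopHolU
  exact norm_holT_sub_one_sub_walkSum_le_of_length_le hs0 hℓ1 hℓs _ _ (length_loopWord_le c i)
    fun st hst => hS st.bond (two_block_of_mem_loopWalk hj c i hst).1 (two_block_of_mem_loopWalk hj c i hst).2

/-- **THE CORRECTION FACTOR TO SECOND ORDER**: `‖eml(W) − 1 − |I|⁻¹ Σ_i Z(loop_i)‖ ≤ 586·ℓ²s²` and `‖eml(W) − 1‖ ≤ 16·ℓs` (`48ℓs ≤ 1`; `exp[mean log]` at the identity
tuple to second order, `BlockAveragingEMLAnalyticMean.norm_eml_one_add_sub_sub_mean_le`, radius `1/12`). [cite: Balaban1987RG1, (0.4)-(0.8) p.253; Balaban1985Averaging, (123) p.36] -/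
theorem norm_eml_loopHolU_sub_one_sub_mean_le (hj : j + 1 ≤ P.m + P.K) {S : GaugeField P j 𝔸ˣ} (c : PBond P (j + 1)) {s : ℝ} (hs0 : 0 ≤ s)
    (hℓs : 48 * (((P.d + 2) * P.L : ℕ) : ℝ) * s ≤ 1)
    (hS : ∀ b : PBond P j, (blockOf b.src = c.src ∨ blockOf b.src = c.tgt) → (blockOf b.tgt = c.src ∨ blockOf b.tgt = c.tgt) →
      ‖((S b : 𝔸ˣ) : 𝔸) - 1‖ ≤ s) :
    ‖eml (fun i : Idx P => ((loopHolU S c i : 𝔸ˣ) : 𝔸)) - 1 -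
        ((Fintype.card (Idx P) : ℂ))⁻¹ • ∑ i : Idx P,
          walkSum (fun b => ((S b : 𝔸ˣ) : 𝔸) - 1) (walk (emb c.src) (loopWord P.L c.dir (off i.1) i.2.1 i.2.2))‖ ≤
        586 * (((P.d + 2) * P.L : ℕ) : ℝ) ^ 2 * s ^ 2 ∧
      ‖eml (fun i : Idx P => ((loopHolU S c i : 𝔸ˣ) : 𝔸)) - 1‖ ≤ 16 * (((P.d + 2) * P.L : ℕ) : ℝ) * s := by
  set ℓ : ℝ := (((P.d + 2) * P.L : ℕ) : ℝ) with hℓ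
  have hℓ0 : 0 ≤ ℓ := Nat.cast_nonneg _
  have h4 : 4 * ℓ * s ≤ 1 := by nlinarith [mul_nonneg hℓ0 hs0]
  set θ : ℝ := 4 * ℓ * s with hθ
  have hθ0 : 0 ≤ θ := by positivity
  have hθ12 : θ ≤ 1 / 12 := by rw [hθ]; nlinarith [mul_nonneg hℓ0 hs0]
  -- the tuple `V = W − 1`
  set V : Idx P → 𝔸 := fun i => ((loopHolU S c i : 𝔸ˣ) : 𝔸) - 1 with hV
  have hVi : ∀ i, ‖V i‖ ≤ θ := fun i => (norm_loopHolU_sub_one_le hj c hs0 h4 hS i).1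
  have hVn : ‖V‖ ≤ θ := (pi_norm_le_iff_of_nonneg hθ0).2 hVi
  have hW : (fun i : Idx P => ((loopHolU S c i : 𝔸ˣ) : 𝔸)) = 1 + V := by
    funext i; simp [hV]
  have heml := norm_eml_one_add_sub_sub_mean_le (ι := Idx P) (𝔸 := 𝔸) (V := V) (hVn.trans hθ12)
  rw [meanCLM_apply] at heml
  have heml' : ‖eml (1 + V) - 1 - ((Fintype.card (Idx P) : ℂ))⁻¹ • ∑ i, V i‖ ≤ 36 * θ ^ 2 :=
    heml.trans (by nlinarith [pow_le_pow_left₀ (norm_nonneg V) hVn 2])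
  -- the mean of `V` vs the mean of the signed sums
  have herr : ‖((Fintype.card (Idx P) : ℂ))⁻¹ • ∑ i, V i -
      ((Fintype.card (Idx P) : ℂ))⁻¹ • ∑ i : Idx P,
        walkSum (fun b => ((S b : 𝔸ˣ) : 𝔸) - 1) (walk (emb c.src) (loopWord P.L c.dir (off i.1) i.2.1 i.2.2))‖ ≤ 10 * ℓ ^ 2 * s ^ 2 := by
    rw [← smul_sub, ← Finset.sum_sub_distrib]
    exact norm_card_inv_smul_sum_le (by positivity) fun i => (norm_loopHolU_sub_one_le hj c hs0 h4 hS i).2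
  rw [hW]
  constructor
  · have e : eml (1 + V) - 1 - ((Fintype.card (Idx P) : ℂ))⁻¹ • ∑ i : Idx P,
          walkSum (fun b => ((S b : 𝔸ˣ) : 𝔸) - 1) (walk (emb c.src) (loopWord P.L c.dir (off i.1) i.2.1 i.2.2)) =
        (eml (1 + V) - 1 - ((Fintype.card (Idx P) : ℂ))⁻¹ • ∑ i, V i) +
          (((Fintype.card (Idx P) : ℂ))⁻¹ • ∑ i, V i - ((Fintype.card (Idx P) : ℂ))⁻¹ • ∑ i : Idx P,
            walkSum (fun b => ((S b : 𝔸ˣ) : 𝔸) - 1) (walk (emb c.src) (loopWord P.L c.dir (off i.1) i.2.1 i.2.2))) := by abel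
    rw [e]
    calc _ ≤ 36 * θ ^ 2 + 10 * ℓ ^ 2 * s ^ 2 := (norm_add_le _ _).trans (add_le_add heml' herr)
      _ = 586 * ℓ ^ 2 * s ^ 2 := by rw [hθ]; ring
  · have hmean : ‖((Fintype.card (Idx P) : ℂ))⁻¹ • ∑ i, V i‖ ≤ θ := norm_card_inv_smul_sum_le hθ0 hVi
    have e : eml (1 + V) - 1 = (eml (1 + V) - 1 - ((Fintype.card (Idx P) : ℂ))⁻¹ • ∑ i, V i) + ((Fintype.card (Idx P) : ℂ))⁻¹ • ∑ i, V i := by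
      abel
    rw [e]
    calc _ ≤ 36 * θ ^ 2 + θ := (norm_add_le _ _).trans (add_le_add heml' hmean)
      _ ≤ 3 * θ + θ := by nlinarith
      _ = 16 * ℓ * s := by rw [hθ]; ring

end Loops

end Summit.QuantumFields.YangMills.Theorems.Prop8Chart

end
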